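import Literature.AlgebraicGeometry.HodgeTheory.CMHodgeGroupDualBases
import Literature.AlgebraicGeometry.Motives.HodgeThetaSubalgebraUnitaryFourTwo
import HarnessLib

/-!
# Skew arithmetic of a CM field acting on a weight-one Hodge structure: traces in an adapted dual basis, the
# `ψ`-symmetric / `ψ`-skew halves `E = E₀ ⊕ E⁻`, rational eigenvalues (Deligne LNM 900 §4; Moonen–Zarhin 1999 §1–2)

Family `hodge`, layer `Literature/AlgebraicGeometry/HodgeTheory` (next to `CMHodgeGroupDualBases` / `CMHodgeGroupLieSocket`).
UNCONDITIONAL; theorems only, no definition, no named fact, no `sorry`. Written for the cell `pub-hodgeav-hg6` (req-37 (A)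
Q2b, TABLE X rows 10 / 12 ALL MEMBERS; design note `HOME/jobs/A7-inventory-eng5g6/DESIGN-rows10-12-allmembers.md`, brick
«UTIL» feeding P4 = the CENTRE input of `CMThetaSocket.mem_spanC_of_lift_of_centre`). HONEST FRAMING of that cell: HC / HC_AV /
HC_CM / H2 NOT proved — this file is linear algebra and discharges nothing by itself.

CONTENT (all Galois-free; `E = End_Hdg(V) = ℚ[φ]`, `W_c = ker(φ_ℂ − c)`, `ψ` a polarization, `†` its Rosati involution):
* §1 traces in a basis: `trace f = Σ_i [f b_i]_i` (`CMArith.trace_eq_sum_repr`), the traceless part of an endomorphism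
  (`CMArith.trace_sub_smul_one_eq_zero`), a sub-basis of an invariant subspace computes the trace of the restriction
  (`CMArith.trace_restrict_eq_sum_repr`, `CMArith.eq_span_of_basis`), and `tr(Θ|_W) = dim (W ∩ V^{1,0}) − dim (W ∩ V^{0,1})`
  for the Hodge operator `Θ` of an effective weight-one structure (`CMArith.trace_restrict_theta`).
* §2 DUAL-BASIS COORDINATES: for a basis `cb` indexed by `(ι × Fin 2) × Fin n₀` in duality with a bilinear form `B`
  (`B(cb_{(k,0),i}, cb_{(k′,1),j}) = δ`, `B = 0` on equal second index — the output of `CMTheta.exists_adaptedDualBasis`),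
  the coordinates are values of `B` (`CMArith.repr_zero_eq`, `CMArith.repr_one_eq`); hence the TRACE FORMULA
  `Tr(S D) = 2 Σ_k τ_k Σ_j [D cb_{(k,0),j}]_{(k,0),j}` for `B`-skew `S, D` with `S` diagonal (`τ_k`) on the `(k,0)`-vectors
  (`CMArith.trace_mul_eq_two_mul_sum`), and the SKEW TRANSFER `S cb_{(k,1),j} = −τ_k cb_{(k,1),j}`
  (`CMArith.apply_eq_neg_smul_of_skew`).
* §3 THE CM FIELD: for `E` commutative with every non-zero element invertible (`hdiv`, `End⁰` of a simple abelian variety):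
  a rational eigenvalue of `a ∈ E` on `V_ℂ` forces `a = q·1` (`CMArith.eq_smul_one_of_apply_eq_smul`), non-zero elements act
  injectively (`CMArith.apply_ne_zero`), and `E⁻ = {a ∈ E : a† = −a}` has dimension `½ dim E`: there are `d` linearly
  independent `ψ`-skew Hodge endomorphisms when `dim E = 2d` and `φ† ≠ φ` (`CMArith.exists_linearIndependent_skew`; proof:
  `E = E₀ ⊕ E⁻` and multiplication by `φ − φ†` exchanges the two halves injectively).

## References
* [Deligne1982HodgeCycles] P. Deligne, LNM 900 (1982), §4 (p. 30: `E ⊗ ℂ = ℂ^{Hom(E,ℂ)}`, `H¹ ⊗ ℂ = ⊕_σ H¹_σ`), I §3.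
* [MoonenZarhin1999LowDim] B. Moonen, Yu. Zarhin, Math. Ann. 315 (1999), §1 («the Rosati involution is complex conjugation on
  the CM field `F`; `F = F₀ ⊕ F⁻`»), §2 (2.3).
* [Huybrechts2016K3] D. Huybrechts, Lectures on K3 surfaces, §3.3.5 (the Rosati involution).
* [Lang2002] S. Lang, Algebra, GTM 211 (2002), Ch. III §5 (bases, dimension), Ch. XIII §3 (matrices and linear maps, the
  trace), §5 (duality, dual bases).
-/

noncomputable section

open scoped TensorProduct
open Module

namespace Literature.AlgebraicGeometry.Motives

namespace HodgeStructure

universe u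

/-! ### §1 Traces in a basis; the trace of `Θ` on an invariant subspace -/

section Basis

variable {K M : Type*} [CommRing K] [AddCommGroup M] [Module K M] {κ : Type*} [Fintype κ] [DecidableEq κ]

/-- **`trace f = Σ_i [f b_i]_i`** (the matrix trace in the basis `b`). [cite: Lang2002, Ch. XIII §3] -/
theorem CMArith.trace_eq_sum_repr (b : Module.Basis κ K M) (f : Module.End K M) :
    LinearMap.trace K M f = ∑ i, b.repr (f (b i)) i := by
  rw [LinearMap.trace_eq_matrix_trace K b, Matrix.trace]
  exact Finset.sum_congr rfl fun i _ => by rw [Matrix.diag_apply, LinearMap.toMatrix_apply]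

/-- **An operator diagonal on a basis has trace the sum of its diagonal values.** [cite: Lang2002, Ch. XIII §3] -/
theorem CMArith.trace_eq_sum_of_apply_basis (b : Module.Basis κ K M) (f : Module.End K M) (s : κ → K)
    (hf : ∀ i, f (b i) = s i • b i) : LinearMap.trace K M f = ∑ i, s i := by
  rw [CMArith.trace_eq_sum_repr b]
  exact Finset.sum_congr rfl fun i _ => by
    rw [hf, map_smul, b.repr_self, Finsupp.smul_apply, Finsupp.single_eq_same, smul_eq_mul, mul_one]

end Basis

section Field

variable {K M : Type*} [Field K] [AddCommGroup M] [Module K M]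

/-- **The traceless part**: `tr(Y − (tr Y / dim) · 1) = 0` on a non-zero finite-dimensional space.
[cite: Lang2002, Ch. XIII §3] -/
theorem CMArith.trace_sub_smul_one_eq_zero [FiniteDimensional K M] (hM : (Module.finrank K M : K) ≠ 0)
    (Y : Module.End K M) :
    LinearMap.trace K M (Y - ((Module.finrank K M : K)⁻¹ * LinearMap.trace K M Y) • 1) = 0 := by
  rw [map_sub, map_smul, LinearMap.trace_one, smul_eq_mul]
  field_simp
  ring

/-- **A subspace of dimension `d` containing `d` vectors of a basis is their span.** [cite: Lang2002, Ch. III §5] -/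
theorem CMArith.eq_span_of_basis {κ : Type*} (b : Module.Basis κ K M) {d : ℕ} (e : Fin d → κ)
    (he : Function.Injective e) (W : Submodule K M) [FiniteDimensional K W] (hW : ∀ j, b (e j) ∈ W)
    (hfin : Module.finrank K W = d) : W = Submodule.span K (Set.range (b ∘ e)) := by
  have hli : LinearIndependent K (b ∘ e) := b.linearIndependent.comp e he
  have hle : Submodule.span K (Set.range (b ∘ e)) ≤ W := Submodule.span_le.2 (by rintro _ ⟨j, rfl⟩; exact hW j)
  refine (Submodule.eq_of_le_of_finrank_eq hle ?_).symm
  rw [finrank_span_eq_card hli, Fintype.card_fin, hfin]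

/-- **Coordinates outside a sub-basis vanish on its span.** [cite: Lang2002, Ch. III §5] -/
theorem CMArith.repr_eq_zero_of_mem_span {κ : Type*} (b : Module.Basis κ K M) {d : ℕ} (e : Fin d → κ)
    {x : M} (hx : x ∈ Submodule.span K (Set.range (b ∘ e))) {i : κ} (hi : ∀ j, e j ≠ i) : b.repr x i = 0 := by
  have h := b.repr_support_subset_of_mem_span (Set.range e) (by rwa [← Set.range_comp])
  by_contra hne
  obtain ⟨j, hj⟩ := h (Finsupp.mem_support_iff.2 hne)
  exact hi j hj

/-- **The trace of a restriction is computed on a sub-basis**: if `W ∋ b_{e j}` (`j < d = dim W`) is `D`-stable, then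
`tr(D|_W) = Σ_j [D b_{e j}]_{e j}`. [cite: Lang2002, Ch. XIII §3] -/
theorem CMArith.trace_restrict_eq_sum_repr {κ : Type*} (b : Module.Basis κ K M) {d : ℕ} (e : Fin d → κ)
    (he : Function.Injective e) (W : Submodule K M) [FiniteDimensional K W] (hW : ∀ j, b (e j) ∈ W)
    (hfin : Module.finrank K W = d) (D : Module.End K M) (hD : ∀ w ∈ W, D w ∈ W) :
    LinearMap.trace K W (D.restrict hD) = ∑ j, b.repr (D (b (e j))) (e j) := by
  classical
  -- the sub-basis of `W`
  set w : Fin d → W := fun j => ⟨b (e j), hW j⟩ with hwdef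
  have hli : LinearIndependent K w := by
    have h : LinearIndependent K (W.subtype ∘ w) := by
      have : W.subtype ∘ w = b ∘ e := funext fun j => rfl
      rw [this]; exact b.linearIndependent.comp e he
    exact h.of_comp
  have hcard : Fintype.card (Fin d) = Module.finrank K W := by rw [Fintype.card_fin, hfin]
  set bW : Module.Basis (Fin d) K W := basisOfLinearIndependentOfCardEqFinrank' w hli hcard with hbWdef
  have hbW : ∀ j, bW j = w j := fun j => by
    rw [hbWdef, coe_basisOfLinearIndependentOfCardEqFinrank']
  -- coordinates in `bW` are coordinates in `b`
  have hrepr : ∀ z : W, ∀ j, bW.repr z j = b.repr (z : M) (e j) := by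
    intro z j
    have hz : (z : M) = ∑ i, bW.repr z i • b (e i) := by
      conv_lhs => rw [← bW.sum_repr z]
      rw [Submodule.coe_sum]
      exact Finset.sum_congr rfl fun i _ => by rw [Submodule.coe_smul, hbW]
    rw [hz, map_sum, Finset.sum_apply']
    simp_rw [map_smul, b.repr_self, Finsupp.smul_apply, smul_eq_mul, Finsupp.single_apply]
    rw [Finset.sum_eq_single j (fun i _ hij => by rw [if_neg (fun h => hij (he h)), mul_zero])
      (fun h => absurd (Finset.mem_univ j) h), if_pos rfl, mul_one]
  rw [CMArith.trace_eq_sum_repr bW]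
  refine Finset.sum_congr rfl fun j _ => ?_
  rw [hrepr, LinearMap.coe_restrict_apply, hbW]

end Field

/-- `Fin 2 = {0, 1}`. [folklore] -/
private theorem CMTheta.fin2_cases' (r : Fin 2) : r = 0 ∨ r = 1 := by
  rcases r with ⟨_ | _ | k, hk⟩
  · exact Or.inl rfl
  · exact Or.inr rfl
  · omega

section Theta

variable {V : Type u} [AddCommGroup V] [Module ℚ V] {n : ℤ}

/-- **`tr(Θ|_W) = dim (W ∩ V^{1,0}) − dim (W ∩ V^{0,1})`** for the Hodge operator `Θ` (`= +1` on `V^{1,0}`, `−1` on `V^{0,1}`)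
of an effective weight-one Hodge structure and a `Θ`-stable subspace `W ⊆ V_ℂ`: `Θ|_W` is an involution whose
`±1`-eigenspaces are `W ∩ V^{1,0}`, `W ∩ V^{0,1}` (`trace_eq_of_involution`). [cite: Deligne1982HodgeCycles, §4 (p. 30)] -/
theorem CMArith.trace_restrict_theta (H : HodgeStructure V n) (hn : n = 1) (heff : H.IsEffective)
    {Θ : Module.End ℂ (ℂ ⊗[ℚ] V)} (hΘ : ∀ p, ∀ x ∈ H.piece p (n - p), Θ x = ((2 * p - n : ℤ) : ℂ) • x)
    {W : Submodule ℂ (ℂ ⊗[ℚ] V)} [FiniteDimensional ℂ W] (hW : ∀ w ∈ W, Θ w ∈ W) :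
    LinearMap.trace ℂ W (Θ.restrict hW) =
      (Module.finrank ℂ ↥(W ⊓ H.piece 1 0) : ℂ) - (Module.finrank ℂ ↥(W ⊓ H.piece 0 1) : ℂ) := by
  obtain ⟨hPhat, hQhat, hΘ10, hΘ01, hΘΘ⟩ := UnitaryTheta.theta_facts H hn heff hΘ
  set ΘW := Θ.restrict hW with hΘWdef
  have hΘWapply : ∀ x : W, ((ΘW x : W) : ℂ ⊗[ℚ] V) = Θ x := fun x => by
    rw [hΘWdef, LinearMap.coe_restrict_apply]
  have hΘWΘW : ΘW * ΘW = 1 := LinearMap.ext fun x => Subtype.ext (by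
    rw [Module.End.mul_apply, hΘWapply, hΘWapply, hΘΘ, Module.End.one_apply])
  set PW : Submodule ℂ W := LinearMap.ker (ΘW - 1) with hPWdef
  set QW : Submodule ℂ W := LinearMap.ker (ΘW + 1) with hQWdef
  have hPW : ∀ x, x ∈ PW ↔ ΘW x = x := fun x => by
    rw [hPWdef, LinearMap.mem_ker, LinearMap.sub_apply, Module.End.one_apply, sub_eq_zero]
  have hQW : ∀ x, x ∈ QW ↔ ΘW x = -x := fun x => by
    rw [hQWdef, LinearMap.mem_ker, LinearMap.add_apply, Module.End.one_apply, add_eq_zero_iff_eq_neg]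
  have hPWeq : PW = Submodule.comap W.subtype (W ⊓ H.piece 1 0) := by
    ext x
    rw [hPW, Submodule.mem_comap, Submodule.subtype_apply, Submodule.mem_inf]
    constructor
    · intro h
      have hx : Θ x = x := by rw [← hΘWapply, h]
      refine ⟨x.2, ?_⟩
      have hx' : (x : ℂ ⊗[ℚ] V) = (2 : ℂ)⁻¹ • ((x : ℂ ⊗[ℚ] V) + Θ x) := by rw [hx]; module
      rw [hx']
      exact hPhat _
    · rintro ⟨-, hx10⟩
      apply Subtype.ext
      rw [hΘWapply]
      exact hΘ10 _ hx10
  have hQWeq : QW = Submodule.comap W.subtype (W ⊓ H.piece 0 1) := by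
    ext x
    rw [hQW, Submodule.mem_comap, Submodule.subtype_apply, Submodule.mem_inf]
    constructor
    · intro h
      have hx : Θ x = -x := by rw [← hΘWapply, h, Submodule.coe_neg]
      refine ⟨x.2, ?_⟩
      have hx' : (x : ℂ ⊗[ℚ] V) = (2 : ℂ)⁻¹ • ((x : ℂ ⊗[ℚ] V) - Θ x) := by rw [hx]; module
      rw [hx']
      exact hQhat _
    · rintro ⟨-, hx01⟩
      apply Subtype.ext
      rw [hΘWapply, Submodule.coe_neg]
      exact hΘ01 _ hx01
  have hfinP : Module.finrank ℂ PW = Module.finrank ℂ ↥(W ⊓ H.piece 1 0) := by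
    rw [hPWeq]; exact (Submodule.comapSubtypeEquivOfLe inf_le_left).finrank_eq
  have hfinQ : Module.finrank ℂ QW = Module.finrank ℂ ↥(W ⊓ H.piece 0 1) := by
    rw [hQWeq]; exact (Submodule.comapSubtypeEquivOfLe inf_le_left).finrank_eq
  rw [trace_eq_of_involution two_ne_zero hΘWΘW hPW hQW, hfinP, hfinQ]

end Theta

/-! ### §2 Coordinates and traces in an adapted dual basis -/

section Dual

variable {K M : Type*} [Field K] [AddCommGroup M] [Module K M] {ι : Type*} [Fintype ι] [DecidableEq ι] {n₀ : ℕ}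
  (cb : Module.Basis ((ι × Fin 2) × Fin n₀) K M) (B : M →ₗ[K] M →ₗ[K] K)
  (hdual : ∀ k k' i j, B (cb ((k, 0), i)) (cb ((k', 1), j)) = if k = k' ∧ i = j then 1 else 0)
  (hiso : ∀ k k' (t : Fin 2) i j, B (cb ((k, t), i)) (cb ((k', t), j)) = 0)
include hdual hiso

omit [Fintype ι] in
/-- **The `(k,0)`-coordinates are values of the form**: `[x]_{(k,0),j} = B(x, cb_{(k,1),j})` (dual bases).
[cite: Lang2002, Ch. XIII §5] -/
theorem CMArith.repr_zero_eq (x : M) (k : ι) (j : Fin n₀) : cb.repr x ((k, 0), j) = B x (cb ((k, 1), j)) := by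
  have h : (cb.coord ((k, 0), j)) = B.flip (cb ((k, 1), j)) := by
    refine cb.ext fun i => ?_
    obtain ⟨⟨k', t⟩, i⟩ := i
    rw [Module.Basis.coord_apply, cb.repr_self, LinearMap.flip_apply, Finsupp.single_apply]
    rcases CMTheta.fin2_cases' t with rfl | rfl
    · rw [hdual]
      by_cases h : k' = k ∧ i = j
      · rw [if_pos h, if_pos (by rw [h.1, h.2])]
      · rw [if_neg h, if_neg (fun h' => h (by
          simp only [Prod.mk.injEq] at h'
          exact ⟨h'.1.1, h'.2⟩))]
    · rw [hiso, if_neg (fun h' => by simp only [Prod.mk.injEq] at h'; exact absurd h'.1.2 (by decide))]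
  have := LinearMap.congr_fun h x
  rwa [Module.Basis.coord_apply, LinearMap.flip_apply] at this

omit [Fintype ι] in
/-- **The `(k,1)`-coordinates are values of the form**: `[x]_{(k,1),j} = B(cb_{(k,0),j}, x)` (dual bases).
[cite: Lang2002, Ch. XIII §5] -/
theorem CMArith.repr_one_eq (x : M) (k : ι) (j : Fin n₀) : cb.repr x ((k, 1), j) = B (cb ((k, 0), j)) x := by
  have h : (cb.coord ((k, 1), j)) = B (cb ((k, 0), j)) := by
    refine cb.ext fun i => ?_
    obtain ⟨⟨k', t⟩, i⟩ := i
    rw [Module.Basis.coord_apply, cb.repr_self, Finsupp.single_apply]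
    rcases CMTheta.fin2_cases' t with rfl | rfl
    · rw [hiso, if_neg (fun h' => by simp only [Prod.mk.injEq] at h'; exact absurd h'.1.2 (by decide))]
    · rw [hdual]
      by_cases h : k = k' ∧ j = i
      · rw [if_pos h, if_pos (by rw [h.1, h.2])]
      · rw [if_neg h, if_neg (fun h' => h (by
          simp only [Prod.mk.injEq] at h'
          exact ⟨h'.1.1.symm, h'.2.symm⟩))]
  have := LinearMap.congr_fun h x
  rwa [Module.Basis.coord_apply] at this

/-- **TRACE FORMULA**: for `B`-skew `S`, `D` with `S cb_{(k,0),j} = τ_k cb_{(k,0),j}` and `S (D cb_{(k,0),j}) = τ_k D cb_{(k,0),j}`,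
`Tr(S D) = 2 Σ_k τ_k Σ_j [D cb_{(k,0),j}]_{(k,0),j}` (the `(k,1)`-diagonal entries of `S D` repeat the `(k,0)` ones by
duality). For `S = y_ℂ`, `y ∈ E⁻`, and `D ∈ 𝔤_ℂ` this is `Tr_V(y D) = 2 Σ_σ σ(y) tr(D|_{W_σ})`. [cite: MoonenZarhin1999LowDim, §2 (2.3)] -/
theorem CMArith.trace_mul_eq_two_mul_sum (S D : Module.End K M) (τ : ι → K)
    (hS : ∀ k j, S (cb ((k, 0), j)) = τ k • cb ((k, 0), j))
    (hSskew : ∀ x y, B (S x) y + B x (S y) = 0) (hDskew : ∀ x y, B (D x) y + B x (D y) = 0)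
    (hSD : ∀ k j, S (D (cb ((k, 0), j))) = τ k • D (cb ((k, 0), j))) :
    LinearMap.trace K M (S * D) = 2 * ∑ k, τ k * ∑ j, cb.repr (D (cb ((k, 0), j))) ((k, 0), j) := by
  rw [CMArith.trace_eq_sum_repr cb, Fintype.sum_prod_type, Fintype.sum_prod_type, Finset.mul_sum]
  refine Finset.sum_congr rfl fun k _ => ?_
  rw [Fin.sum_univ_two, Finset.mul_sum, ← Finset.sum_add_distrib, Finset.mul_sum]
  refine Finset.sum_congr rfl fun j _ => ?_
  have h0 : cb.repr ((S * D) (cb ((k, 0), j))) ((k, 0), j) = τ k * cb.repr (D (cb ((k, 0), j))) ((k, 0), j) := by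
    rw [Module.End.mul_apply, hSD, map_smul, Finsupp.smul_apply, smul_eq_mul]
  have h1 : cb.repr ((S * D) (cb ((k, 1), j))) ((k, 1), j) = τ k * cb.repr (D (cb ((k, 0), j))) ((k, 0), j) := by
    rw [CMArith.repr_one_eq cb B hdual hiso, CMArith.repr_zero_eq cb B hdual hiso, Module.End.mul_apply]
    have e1 := hSskew (cb ((k, 0), j)) (D (cb ((k, 1), j)))
    have e2 := hDskew (cb ((k, 0), j)) (cb ((k, 1), j))
    rw [hS, map_smul, LinearMap.smul_apply, smul_eq_mul] at e1
    linear_combination e1 - τ k * e2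
  rw [h0, h1]
  ring

omit [Fintype ι] in
/-- **SKEW TRANSFER**: a `B`-skew `S` diagonal (`τ_k`) on the `(k,0)`-vectors and preserving the span of the
`(k,1)`-vectors acts there by `−τ_k`. (For `y ∈ E⁻`: `σ̄(y) = −σ(y)`, «the Rosati involution is complex conjugation on
`F`».) [cite: MoonenZarhin1999LowDim, §1] -/
theorem CMArith.apply_eq_neg_smul_of_skew (S : Module.End K M) (τ : ι → K)
    (hS : ∀ k j, S (cb ((k, 0), j)) = τ k • cb ((k, 0), j)) (hSskew : ∀ x y, B (S x) y + B x (S y) = 0)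
    (hS1 : ∀ k j, S (cb ((k, 1), j)) ∈ Submodule.span K (Set.range (cb ∘ fun i : Fin n₀ => ((k, (1 : Fin 2)), i))))
    (k : ι) (j : Fin n₀) : S (cb ((k, 1), j)) = -(τ k • cb ((k, 1), j)) := by
  refine cb.ext_elem fun i => ?_
  obtain ⟨⟨k', t⟩, i⟩ := i
  rw [map_neg, map_smul, cb.repr_self, Finsupp.neg_apply, Finsupp.smul_apply, Finsupp.single_apply, smul_eq_mul]
  rcases CMTheta.fin2_cases' t with rfl | rfl
  · rw [if_neg (fun h' => by simp only [Prod.mk.injEq] at h'; exact absurd h'.1.2 (by decide)), mul_zero, neg_zero]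
    by_cases hk : k' = k
    · subst hk
      rw [CMArith.repr_zero_eq cb B hdual hiso]
      -- `S cb_{(k,1),j} ∈ span (cb_{(k,1),·})` pairs trivially with `cb_{(k',1),i}`
      obtain ⟨c, hc⟩ := (Submodule.mem_span_range_iff_exists_fun K).1 (hS1 k' j)
      rw [← hc, map_sum, LinearMap.sum_apply]
      refine Finset.sum_eq_zero fun a _ => ?_
      rw [map_smul, LinearMap.smul_apply, Function.comp_apply, hiso, smul_zero]
    · exact CMArith.repr_eq_zero_of_mem_span cb _ (hS1 k j) fun a h => hk (by
        simp only [Prod.mk.injEq] at h; exact h.1.1.symm)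
  · rw [CMArith.repr_one_eq cb B hdual hiso]
    have e1 := hSskew (cb ((k', 0), i)) (cb ((k, 1), j))
    rw [hS, map_smul, LinearMap.smul_apply, smul_eq_mul, hdual] at e1
    by_cases h : k' = k ∧ i = j
    · obtain ⟨rfl, rfl⟩ := h
      rw [if_pos ⟨rfl, rfl⟩] at e1
      rw [if_pos rfl]
      linear_combination e1
    · rw [if_neg h] at e1
      rw [if_neg (fun h' => h (by simp only [Prod.mk.injEq] at h'; exact ⟨h'.1.1.symm, h'.2.symm⟩))]
      linear_combination e1

end Dual

/-! ### §3 The CM field `E`: rational eigenvalues, injectivity, `dim E⁻ = ½ dim E` -/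

section CMField

variable {V : Type u} [AddCommGroup V] [Module ℚ V] {n : ℤ}

/-- Rational scalars act on `V_ℂ` through `ℚ ⊆ ℂ`. [folklore] -/
private theorem CMArith.ratCast_smul_eq (q : ℚ) (z : ℂ ⊗[ℚ] V) : (q : ℂ) • z = q • z := by
  rw [← algebraMap_smul ℂ q z, eq_ratCast]

/-- `(q · 1)_ℂ w = q w`. [folklore] -/
private theorem CMArith.baseChange_smul_one_apply (q : ℚ) (w : ℂ ⊗[ℚ] V) :
    ((q • (1 : Module.End ℚ V)).baseChange ℂ) w = (q : ℂ) • w := by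
  rw [LinearMap.baseChange_smul, LinearMap.smul_apply, LinearMap.baseChange_one, Module.End.one_apply,
    CMArith.ratCast_smul_eq]

/-- **A RATIONAL EIGENVALUE FORCES A SCALAR**: if every non-zero Hodge endomorphism is (left) invertible (`End⁰` of a
simple abelian variety is a division algebra) and `a ∈ End_Hdg(V)` has `a_ℂ w = q w` for some `w ≠ 0` and `q ∈ ℚ`, then
`a = q · 1` (`a − q·1 ∈ End_Hdg(V)` has a kernel vector). [cite: MoonenZarhin1999LowDim, §1] -/
theorem CMArith.eq_smul_one_of_apply_eq_smul (H : HodgeStructure V n)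
    (hdiv : ∀ a ∈ H.endAlg, a ≠ 0 → ∃ b : Module.End ℚ V, b * a = 1) {a : Module.End ℚ V} (ha : a ∈ H.endAlg)
    {q : ℚ} {w : ℂ ⊗[ℚ] V} (hw : w ≠ 0) (haw : a.baseChange ℂ w = (q : ℂ) • w) : a = q • 1 := by
  by_contra hne
  have hd : a - q • 1 ∈ H.endAlg := H.endAlg.sub_mem ha (H.endAlg.smul_mem (one_mem _) q)
  obtain ⟨b, hb⟩ := hdiv _ hd (sub_ne_zero.2 hne)
  have h0 : (a - q • 1).baseChange ℂ w = 0 := by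
    rw [LinearMap.baseChange_sub, LinearMap.sub_apply, haw, CMArith.baseChange_smul_one_apply, sub_self]
  have h1 := LinearMap.congr_fun (congrArg (LinearMap.baseChange ℂ) hb) w
  rw [LinearMap.baseChange_mul, Module.End.mul_apply, h0, map_zero, LinearMap.baseChange_one,
    Module.End.one_apply] at h1
  exact hw h1.symm

/-- **Non-zero Hodge endomorphisms act injectively on `V_ℂ`** (under `hdiv`). [cite: MoonenZarhin1999LowDim, §1] -/
theorem CMArith.apply_ne_zero (H : HodgeStructure V n)
    (hdiv : ∀ a ∈ H.endAlg, a ≠ 0 → ∃ b : Module.End ℚ V, b * a = 1) {a : Module.End ℚ V} (ha : a ∈ H.endAlg)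
    (ha0 : a ≠ 0) {w : ℂ ⊗[ℚ] V} (hw : w ≠ 0) : a.baseChange ℂ w ≠ 0 := fun h =>
  ha0 (by
    have h' := CMArith.eq_smul_one_of_apply_eq_smul H hdiv ha hw (q := 0) (by rw [h, Rat.cast_zero, zero_smul])
    rwa [zero_smul] at h')

variable [Module.Finite ℚ V]

/-- **`dim E⁻ = ½ dim E`**: if `E = End_Hdg(V)` is commutative of dimension `2d` with every non-zero element (left)
invertible and contains a non-zero `ψ`-skew element `s`, then it contains `d` linearly independent `ψ`-skew elements.
PROOF: `E = E₀ ⊕ E⁻` (`a = ½(a + a†) + ½(a − a†)`, `a† ∈ E`; a symmetric and skew `a` has `ψ(a v, w) = 0`), and `a ↦ s a`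
maps `E₀ ↪ E⁻` and `E⁻ ↪ E₀`, so `dim E₀ = dim E⁻ = d`. («`F = F₀ ⊕ F⁻`, the Rosati involution is complex conjugation on
the CM field `F`», Moonen–Zarhin §1.) [cite: MoonenZarhin1999LowDim, §1] [cite: Huybrechts2016K3, §3.3.5] -/
theorem CMArith.exists_linearIndependent_skew (H : HodgeStructure V n) (ψ : H.Polarization)
    (hEcomm : ∀ a ∈ H.endAlg, ∀ b ∈ H.endAlg, a * b = b * a)
    (hdiv : ∀ a ∈ H.endAlg, a ≠ 0 → ∃ b : Module.End ℚ V, b * a = 1) {d : ℕ}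
    (hEdim : Module.finrank ℚ H.endAlg = 2 * d) {s : Module.End ℚ V} (hs : s ∈ H.endAlg) (hs0 : s ≠ 0)
    (hsskew : ∀ v w, ψ.form (s v) w + ψ.form v (s w) = 0) :
    ∃ y : Fin d → Module.End ℚ V, LinearIndependent ℚ y ∧ (∀ i, y i ∈ H.endAlg) ∧
      ∀ i v w, ψ.form (y i v) w + ψ.form v (y i w) = 0 := by
  classical
  -- the two halves
  let Ep : Submodule ℚ (Module.End ℚ V) :=
    { carrier := {a | a ∈ H.endAlg ∧ ∀ v w, ψ.form (a v) w = ψ.form v (a w)}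
      add_mem' := fun {a b} ha hb => ⟨add_mem ha.1 hb.1, fun v w => by
        rw [LinearMap.add_apply, LinearMap.add_apply, map_add, LinearMap.add_apply, map_add, ha.2, hb.2]⟩
      zero_mem' := ⟨zero_mem _, fun v w => by
        rw [LinearMap.zero_apply, LinearMap.zero_apply, map_zero, LinearMap.zero_apply, map_zero]⟩
      smul_mem' := fun c a ha => ⟨H.endAlg.smul_mem ha.1 c, fun v w => by
        rw [LinearMap.smul_apply, LinearMap.smul_apply, map_smul, LinearMap.smul_apply, map_smul, ha.2]⟩ }
  let Em : Submodule ℚ (Module.End ℚ V) :=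
    { carrier := {a | a ∈ H.endAlg ∧ ∀ v w, ψ.form (a v) w + ψ.form v (a w) = 0}
      add_mem' := fun {a b} ha hb => ⟨add_mem ha.1 hb.1, fun v w => by
        rw [LinearMap.add_apply, LinearMap.add_apply, map_add, LinearMap.add_apply, map_add]
        linear_combination ha.2 v w + hb.2 v w⟩
      zero_mem' := ⟨zero_mem _, fun v w => by
        rw [LinearMap.zero_apply, LinearMap.zero_apply, map_zero, LinearMap.zero_apply, map_zero, add_zero]⟩
      smul_mem' := fun c a ha => ⟨H.endAlg.smul_mem ha.1 c, fun v w => by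
        rw [LinearMap.smul_apply, LinearMap.smul_apply, map_smul, LinearMap.smul_apply, map_smul, smul_eq_mul,
          smul_eq_mul]
        linear_combination c * ha.2 v w⟩ }
  have hEp : ∀ a, a ∈ Ep ↔ a ∈ H.endAlg ∧ ∀ v w, ψ.form (a v) w = ψ.form v (a w) := fun a => Iff.rfl
  have hEm : ∀ a, a ∈ Em ↔ a ∈ H.endAlg ∧ ∀ v w, ψ.form (a v) w + ψ.form v (a w) = 0 := fun a => Iff.rfl
  -- `E₀ ∩ E⁻ = 0`
  have hinf : Ep ⊓ Em = ⊥ := by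
    rw [eq_bot_iff]
    intro a ha
    obtain ⟨⟨-, hsym⟩, ⟨-, hskw⟩⟩ := Submodule.mem_inf.1 ha
    rw [Submodule.mem_bot]
    refine LinearMap.ext fun v => ψ.nondegenerate.1 _ fun w => ?_
    have h := hskw v w
    rw [← hsym v w, ← two_mul, mul_eq_zero] at h
    exact h.resolve_left two_ne_zero
  -- `E = E₀ + E⁻`
  have hsup : Ep ⊔ Em = Subalgebra.toSubmodule H.endAlg := by
    apply le_antisymm
    · exact sup_le (fun a ha => ha.1) (fun a ha => ha.1)
    · intro a ha
      rw [Subalgebra.mem_toSubmodule] at ha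
      have hadj := ψ.adjoint_mem_endAlg ha
      have hdec : a = (2 : ℚ)⁻¹ • (a + ψ.adjoint a) + (2 : ℚ)⁻¹ • (a - ψ.adjoint a) := by module
      rw [hdec]
      refine Submodule.add_mem _ (Submodule.mem_sup_left (Ep.smul_mem _ ⟨add_mem ha hadj, fun v w => ?_⟩))
        (Submodule.mem_sup_right (Em.smul_mem _ ⟨sub_mem ha hadj, fun v w => ?_⟩))
      · rw [LinearMap.add_apply, LinearMap.add_apply, map_add, LinearMap.add_apply, map_add,
          ψ.form_apply_adjoint, ψ.isAdjointPair_adjoint_left a v w, add_comm]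
      · rw [LinearMap.sub_apply, LinearMap.sub_apply, map_sub, LinearMap.sub_apply, map_sub,
          ψ.form_apply_adjoint, ψ.isAdjointPair_adjoint_left a v w]
        ring
  have hsum : Module.finrank ℚ Ep + Module.finrank ℚ Em = 2 * d := by
    rw [← Submodule.finrank_sup_add_finrank_inf_eq, hinf, finrank_bot, add_zero, hsup,
      Subalgebra.finrank_toSubmodule, hEdim]
  -- multiplication by `s` is injective and exchanges the halves
  obtain ⟨b, hb⟩ := hdiv s hs hs0
  have hinj : Function.Injective (LinearMap.mulLeft ℚ s) := by
    rw [← LinearMap.ker_eq_bot, eq_bot_iff]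
    intro a ha
    rw [LinearMap.mem_ker, LinearMap.mulLeft_apply] at ha
    rw [Submodule.mem_bot, ← one_mul a, ← hb, mul_assoc, ha, mul_zero]
  have hsa : ∀ a ∈ H.endAlg, ∀ v, s (a v) = a (s v) := fun a ha v => by
    rw [← Module.End.mul_apply, hEcomm s hs a ha, Module.End.mul_apply]
  have hpm : Ep.map (LinearMap.mulLeft ℚ s) ≤ Em := by
    rintro _ ⟨a, ha, rfl⟩
    refine ⟨H.endAlg.mul_mem hs ha.1, fun v w => ?_⟩
    rw [LinearMap.mulLeft_apply, Module.End.mul_apply, Module.End.mul_apply, hsa a ha.1 v, ha.2 (s v) w]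
    exact hsskew v (a w)
  have hmp : Em.map (LinearMap.mulLeft ℚ s) ≤ Ep := by
    rintro _ ⟨a, ha, rfl⟩
    refine ⟨H.endAlg.mul_mem hs ha.1, fun v w => ?_⟩
    rw [LinearMap.mulLeft_apply, Module.End.mul_apply, Module.End.mul_apply, hsa a ha.1 w]
    have h1 := hsskew (a v) w
    have h2 := ha.2 v (s w)
    linear_combination h1 - h2
  have hle1 : Module.finrank ℚ Ep ≤ Module.finrank ℚ Em := by
    rw [(Submodule.equivMapOfInjective _ hinj Ep).finrank_eq]
    exact Submodule.finrank_mono hpm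
  have hle2 : Module.finrank ℚ Em ≤ Module.finrank ℚ Ep := by
    rw [(Submodule.equivMapOfInjective _ hinj Em).finrank_eq]
    exact Submodule.finrank_mono hmp
  have hEmd : Module.finrank ℚ Em = d := by omega
  -- a basis of `E⁻`
  set bm : Module.Basis (Fin d) ℚ Em := (Module.finBasis ℚ Em).reindex (finCongr hEmd) with hbm
  refine ⟨fun i => (bm i : Module.End ℚ V), ?_, fun i => ((hEm _).1 (bm i).2).1, fun i => ((hEm _).1 (bm i).2).2⟩
  exact bm.linearIndependent.map' Em.subtype Em.ker_subtype

end CMField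

end HodgeStructure

end Literature.AlgebraicGeometry.Motives
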